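import Summits.CriticalPhenomena.PercolationContinuityZ3.Theorems.PercNearOneGluingNoHeavyLowerTailTwoPartitionThreeSet
import Mathlib.Algebra.BigOperators.Ring.Finset
import Mathlib.Algebra.Order.BigOperators.Group.Finset
import Mathlib.Tactic.Ring
import Mathlib.Tactic.Linarith
import HarnessLib.Audit

/-!
# `NoHeavyLowerTail` (crux stmt-CriticalPhenomena-4575), master-family hierarchy P3 (gen 26): the WEIGHTED form of the three-set
# antipodal functional — `ThreeSetAntipodal` is one instance of a two-set inequality that is LINEAR in a weight `F`

Support file (seat `prim-masterthm-p3`; `--supports stmt-CriticalPhenomena-4575`; memo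
`run/shared/lean/prim/prim-masterthm/FROM-prim-masterthm-p3-g26-JUNTA-LIFT-AND-K6-CENSUS.md` §5, HIERARCHY §34).

THE REFORMULATION (this work).  For a weight `F : Finset α → ℤ` and families `ℬ, 𝒞` put

  `wbForm F ℬ 𝒞 := 2·∑_{S ∈ ℬ ∩ 𝒞} F S − ∑_{S ∈ ℬ ∩ 𝒞ᶜˢ} (F S + F Sᶜ)`.

Dualising the three-set functional in its FIRST argument: for every family `𝒜`,
`2·threeSetN 𝒜 ℬ 𝒞 = wbForm F_𝒜 ℬ 𝒞` with the weight `F_𝒜 = 1_𝒜 − 1_{𝒜ᶜˢ ∖ 𝒜}` (`two_mul_threeSetN_eq_wbForm`), and `F_𝒜` is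
monotone with `F_𝒜(S) + F_𝒜(Sᶜ) ≥ 0` whenever `𝒜` is an up-set.  Hence the conjecture

  **`WeightedBase`**: for every finite cube, every MONOTONE `F` with `F(S) + F(Sᶜ) ≥ 0` for all `S`, and all up-sets `ℬ, 𝒞`: `0 ≤ wbForm F ℬ 𝒞`

implies `ThreeSetAntipodal` (`threeSetAntipodal_of_weightedBase`).  `F ≡ 1` is Harris–Kleitman twice (`wbForm_one_nonneg`, proved here);
`F = 1_𝒜 − 1_{σ𝒜∖𝒜}` is `ThreeSetAntipodal`.  Why this matters (memo §5): `wbForm` is LINEAR in `F`, the admissible weights form the cone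
`{F monotone, F + F∘σ ≥ 0}` whose extreme rays are `1_A − 1_D` (A up, D down, D ⊆ σA), and by LP duality `WeightedBase` for a fixed pair `(ℬ,𝒞)`
is equivalent to an `𝒜`-FREE flow statement ('Lipschitz routing': an antipodally symmetric fractional Harris flow of `ℬ ∩ 𝒞` whose quotient
capacities ship one unit from every 'bad' antipodal pair to the 'good' ones) — verified by LP for ALL pairs of up-sets of `2^[n]`, `n ≤ 4`
(28 224 pairs at `n = 4`) and for thousands of sampled pairs at `n = 5, 6, 7` (each certifying `ThreeSetAntipodal` for that `(ℬ,𝒞)` and EVERY `𝒜`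
at once); adversarial search at `n ≤ 6` finds margin exactly `0`, never negative.  EVIDENCE, not kernel facts.
HONEST LABEL: a reformulation (proved), an easy face (proved) and a conjecture (open); nothing here bears on the crux. [this work]
-/

namespace Summit.CriticalPhenomena.PercolationContinuityZ3.Theorems.TwoPartition

open Finset
open scoped FinsetFamily

variable {α : Type*} [DecidableEq α] [Fintype α]

/-- The weighted two-set form `2·∑_{ℬ∩𝒞} F − ∑_{ℬ∩𝒞ᶜˢ} (F(S) + F(Sᶜ))`. [this work] -/
def wbForm (F : Finset α → ℤ) (ℬ 𝒞 : Finset (Finset α)) : ℤ :=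
  2 * ∑ S ∈ ℬ ∩ 𝒞, F S - ∑ S ∈ ℬ ∩ 𝒞ᶜˢ, (F S + F Sᶜ)

/-- **CONJECTURE `WeightedBase`** (this work; open): for every monotone weight `F` on a finite cube with `F(S) + F(Sᶜ) ≥ 0` and all up-sets
`ℬ, 𝒞`, `0 ≤ wbForm F ℬ 𝒞`.  Equivalent (LP duality, memo §5) to the 'Lipschitz-routing' flow statement; implies `ThreeSetAntipodal`
(`threeSetAntipodal_of_weightedBase`).  Verified by LP for all pairs of up-sets of `2^[n]`, `n ≤ 4`, and sampled `n ≤ 7`; an obligation /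
hypothesis — never a fact. [this work] [status: open] -/
@[conjecture] def WeightedBase : Prop :=
  ∀ (n : ℕ) (F : Finset (Fin n) → ℤ) (ℬ 𝒞 : Finset (Finset (Fin n))), Monotone F → (∀ S, 0 ≤ F S + F Sᶜ) →
    IsUpperSet (ℬ : Set (Finset (Fin n))) → IsUpperSet (𝒞 : Set (Finset (Fin n))) → 0 ≤ wbForm F ℬ 𝒞

/-! ### `threeSetN` is the weighted form at `F = 1_𝒜 − 1_{𝒜ᶜˢ ∖ 𝒜}` -/

/-- The Base weight of a family: `+1` on `𝒜`, `−1` on `𝒜ᶜˢ ∖ 𝒜` (the sets outside `𝒜` whose complement is in `𝒜`), `0` elsewhere. [this work] -/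
def baseWeight (𝒜 : Finset (Finset α)) (S : Finset α) : ℤ :=
  (if S ∈ 𝒜 then 1 else 0) - (if S ∉ 𝒜 ∧ Sᶜ ∈ 𝒜 then 1 else 0)

/-- For an up-set, the Base weight is monotone. [this work] -/
theorem baseWeight_monotone {𝒜 : Finset (Finset α)} (h𝒜 : IsUpperSet (𝒜 : Set (Finset α))) : Monotone (baseWeight 𝒜) := by
  intro S T hST
  unfold baseWeight
  have h1 : S ∈ 𝒜 → T ∈ 𝒜 := fun h => h𝒜 hST h
  have h2 : Tᶜ ∈ 𝒜 → Sᶜ ∈ 𝒜 := fun h => h𝒜 (compl_subset_compl.2 hST) h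
  by_cases hS : S ∈ 𝒜 <;> by_cases hT : T ∈ 𝒜 <;> by_cases hSc : Sᶜ ∈ 𝒜 <;> by_cases hTc : Tᶜ ∈ 𝒜 <;>
    simp only [hS, hT, hSc, hTc] <;> simp_all

/-- The Base weight satisfies `F(S) + F(Sᶜ) ≥ 0` (it equals `2·[S ∈ 𝒜 ∩ 𝒜ᶜˢ]`). [this work] -/
theorem baseWeight_add_compl_nonneg (𝒜 : Finset (Finset α)) (S : Finset α) : 0 ≤ baseWeight 𝒜 S + baseWeight 𝒜 Sᶜ := by
  unfold baseWeight
  rw [compl_compl]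
  by_cases hS : S ∈ 𝒜 <;> by_cases hSc : Sᶜ ∈ 𝒜 <;> simp [hS, hSc]

omit [Fintype α] in
/-- Counting as a sum of an indicator over a family. [this work] -/
theorem card_inter_eq_sum_ite (𝒳 𝒴 : Finset (Finset α)) : (#(𝒳 ∩ 𝒴) : ℤ) = ∑ S ∈ 𝒳, if S ∈ 𝒴 then 1 else 0 := by
  rw [Finset.sum_ite_mem, Finset.card_eq_sum_ones, Nat.cast_sum]
  simp

/-- **`2·threeSetN = wbForm` at the Base weight** (this work): the three-set antipodal functional, read in its 'form (c)'
`#(𝒜ℬ𝒞) − #((𝒜ᶜˢ∖𝒜)ℬ𝒞) − #((𝒜∩𝒜ᶜˢ)ℬ𝒞ᶜˢ)`, is half the weighted form at `F = 1_𝒜 − 1_{𝒜ᶜˢ∖𝒜}`. [this work] -/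
theorem two_mul_threeSetN_eq_wbForm (𝒜 ℬ 𝒞 : Finset (Finset α)) :
    2 * threeSetN 𝒜 ℬ 𝒞 = wbForm (baseWeight 𝒜) ℬ 𝒞 := by
  -- form (a) → form (c): #(𝒜ℬ𝒞 ∩ 𝒜ᶜˢ) and #(𝒜 ∩ ℬᶜˢ ∩ 𝒞ᶜˢ) combine by the antipode into #((𝒜ᶜˢ ∖ 𝒜) ∩ ℬ ∩ 𝒞)
  have hanti : #(𝒜 ∩ ℬᶜˢ ∩ 𝒞ᶜˢ) = #(𝒜ᶜˢ ∩ ℬ ∩ 𝒞) := by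
    rw [← card_compls (𝒜 ∩ ℬᶜˢ ∩ 𝒞ᶜˢ), compls_inter, compls_inter, compls_compls, compls_compls]
  have hsplit : (#(𝒜ᶜˢ ∩ ℬ ∩ 𝒞) : ℤ) = #(𝒜 ∩ ℬ ∩ 𝒞 ∩ 𝒜ᶜˢ) + #((𝒜ᶜˢ \ 𝒜) ∩ ℬ ∩ 𝒞) := by
    have h := card_filter_add_card_filter_not (s := 𝒜ᶜˢ ∩ ℬ ∩ 𝒞) (fun S => S ∈ 𝒜)
    have e1 : (𝒜ᶜˢ ∩ ℬ ∩ 𝒞).filter (fun S => S ∈ 𝒜) = 𝒜 ∩ ℬ ∩ 𝒞 ∩ 𝒜ᶜˢ := by ext S; simp [and_comm, and_left_comm]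
    have e2 : (𝒜ᶜˢ ∩ ℬ ∩ 𝒞).filter (fun S => S ∉ 𝒜) = (𝒜ᶜˢ \ 𝒜) ∩ ℬ ∩ 𝒞 := by ext S; simp [and_comm, and_assoc]
    rw [e1, e2] at h
    exact_mod_cast h.symm
  unfold threeSetN wbForm
  rw [hanti]
  -- now everything as sums over ℬ of indicators
  have t1 : (#(𝒜 ∩ ℬ ∩ 𝒞) : ℤ) = ∑ S ∈ ℬ ∩ 𝒞, if S ∈ 𝒜 then 1 else 0 := by
    rw [show 𝒜 ∩ ℬ ∩ 𝒞 = (ℬ ∩ 𝒞) ∩ 𝒜 from by ext; simp [and_comm, and_left_comm], card_inter_eq_sum_ite]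
  have t2 : (#((𝒜ᶜˢ \ 𝒜) ∩ ℬ ∩ 𝒞) : ℤ) = ∑ S ∈ ℬ ∩ 𝒞, if S ∉ 𝒜 ∧ Sᶜ ∈ 𝒜 then 1 else 0 := by
    rw [show (𝒜ᶜˢ \ 𝒜) ∩ ℬ ∩ 𝒞 = (ℬ ∩ 𝒞) ∩ (𝒜ᶜˢ \ 𝒜) from by ext; simp [and_comm, and_left_comm], card_inter_eq_sum_ite]
    refine Finset.sum_congr rfl fun S _ => ?_
    simp only [mem_sdiff, mem_compls, and_comm]
  have t3 : (#(𝒜 ∩ ℬ ∩ 𝒜ᶜˢ ∩ 𝒞ᶜˢ) : ℤ) = ∑ S ∈ ℬ ∩ 𝒞ᶜˢ, if S ∈ 𝒜 ∧ Sᶜ ∈ 𝒜 then 1 else 0 := by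
    rw [show 𝒜 ∩ ℬ ∩ 𝒜ᶜˢ ∩ 𝒞ᶜˢ = (ℬ ∩ 𝒞ᶜˢ) ∩ (𝒜 ∩ 𝒜ᶜˢ) from by ext; simp [and_comm, and_left_comm, and_assoc],
      card_inter_eq_sum_ite]
    refine Finset.sum_congr rfl fun S _ => ?_
    simp only [mem_inter, mem_compls]
  rw [hsplit, t1, t2, t3]
  -- the weighted side, pointwise
  have w1 : ∑ S ∈ ℬ ∩ 𝒞, baseWeight 𝒜 S = ∑ S ∈ ℬ ∩ 𝒞, ((if S ∈ 𝒜 then (1:ℤ) else 0) - (if S ∉ 𝒜 ∧ Sᶜ ∈ 𝒜 then 1 else 0)) := rfl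
  have w2 : ∑ S ∈ ℬ ∩ 𝒞ᶜˢ, (baseWeight 𝒜 S + baseWeight 𝒜 Sᶜ) = ∑ S ∈ ℬ ∩ 𝒞ᶜˢ, 2 * (if S ∈ 𝒜 ∧ Sᶜ ∈ 𝒜 then (1:ℤ) else 0) := by
    refine Finset.sum_congr rfl fun S _ => ?_
    unfold baseWeight
    rw [compl_compl]
    by_cases hS : S ∈ 𝒜 <;> by_cases hSc : Sᶜ ∈ 𝒜 <;> simp [hS, hSc]
  rw [w1, w2, Finset.sum_sub_distrib, ← Finset.mul_sum]
  ring

/-- **`WeightedBase ⟹ ThreeSetAntipodal`** (this work). [this work] -/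
theorem threeSetAntipodal_of_weightedBase (h : WeightedBase) : ThreeSetAntipodal := by
  intro n 𝒜 ℬ 𝒞 h𝒜 hℬ h𝒞
  have h2 := h n (baseWeight 𝒜) ℬ 𝒞 (baseWeight_monotone h𝒜) (baseWeight_add_compl_nonneg 𝒜) hℬ h𝒞
  rw [← two_mul_threeSetN_eq_wbForm] at h2
  linarith

/-- The easy ray `F ≡ 1`: `wbForm 1 ℬ 𝒞 = 2·twoPartN ℬ 𝒞 ≥ 0` (Harris–Kleitman twice). [this work] -/
theorem wbForm_one_nonneg {ℬ 𝒞 : Finset (Finset α)} (hℬ : IsUpperSet (ℬ : Set (Finset α)))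
    (h𝒞 : IsUpperSet (𝒞 : Set (Finset α))) : 0 ≤ wbForm (fun _ => 1) ℬ 𝒞 := by
  have h := twoPartN_nonneg hℬ h𝒞
  unfold twoPartN at h
  unfold wbForm
  simp only [Finset.sum_const, nsmul_eq_mul]
  linarith

end Summit.CriticalPhenomena.PercolationContinuityZ3.Theorems.TwoPartition
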